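import Mathlib
import Summits.Ventures.PercRepro2.CoinTraceReduce
import Summits.Ventures.PercRepro2.CoinTwoStar
import Summits.Ventures.PercRepro2.CoinKStarAbstract
import Summits.Ventures.PercRepro2.CoinKStarTrace

/-!
# Row 2′DARC at every head whose SUB-HEAD has a LOG-SUPERMODULAR trace law (blind cell
PercRepro2, night-2 g5; proofs/NIGHT2-DARC.md §27)

THEOREM `darc_of_lsmHead_mixed`: the head `P = {w} ∪ Vs` closed out into the single target `t`;
every out-coin of `w` is a single-arc ARM `c v = {w → v}` into a subset `A ⊆ Vs`; no arc from
`Vs` back to `w`;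
and the trace law `L ↦ P(K⁻ ∩ Vs = L)` of the sub-head `Vs` (from its own coins) is
LOG-SUPERMODULAR on `2^{Vs}` (`hβ`).  Arm probabilities, the coins inside `Vs` and the entries from
the core are otherwise arbitrary; `a, b, u ∉ P ∪ {t}`; the reduced avoidance events non-degenerate.
Then `DARC p arcs s {t} a b u w`.  This is the k-star theorem with the product leaf law replaced by
the only property the proof uses: the trace law of the head minus `w` splits as
`P(trace = L, w ∉ K⁻) = β L · ∏_{v ∈ L} (1 − p (c v))` (independence of the arm coins from the
sub-head coins, `prob_inter_eq_mul_of_dependsOn`) and `β` is log-supermodular — true for every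
pendant FOREST below `t` (§27.2), hence for heads with any number of routes of any lengths.
-/

namespace Summit.Ventures.PercRepro2.Coin

section LsmHead

open Classical

variable {V : Type*} {E : Type*} [Fintype V] [DecidableEq V] [Fintype E] [DecidableEq E]
  {R : Type*} [Field R] [LinearOrder R] [IsStrictOrderedRing R]


/-! ### The structure of the head: arms into the sub-head -/

variable {arcs : E → Finset (V × V)} {w t : V} {Vs A : Finset V} {c : V → E}

omit [Fintype V] [Fintype E] [DecidableEq E] in
/-- The sub-head is closed out into `{t}` (no arc from `Vs` returns to `w`). -/
lemma lsmHead_closedOut_sub (hclosed : ClosedOut arcs (insert w Vs) {t})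
    (hnoback : ∀ e, ∀ xy ∈ arcs e, xy.1 ∈ Vs → xy.2 ≠ w) : ClosedOut arcs Vs {t} := by
  intro e xy hxy hx
  have h := hclosed e xy hxy (Finset.mem_insert_of_mem hx)
  rcases Finset.mem_union.mp h with h | h
  · rcases Finset.mem_insert.mp h with h | h
    · exact absurd h (hnoback e xy hxy hx)
    · exact Finset.mem_union_left _ h
  · exact Finset.mem_union_right _ h

omit [Fintype V] [DecidableEq V] [Fintype E] [DecidableEq E] in
/-- An arm coin carries no arc with tail in the sub-head. -/
lemma lsmHead_arm_notMem_tailCoins (hwV : w ∉ Vs) (hc : ∀ v ∈ A, arcs (c v) = {(w, v)})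
    {v : V} (hv : v ∈ A) : c v ∉ tailCoins arcs Vs := by
  rintro ⟨xy, hxy, hx⟩
  rw [hc v hv, Finset.mem_singleton] at hxy
  subst hxy
  exact hwV hx

omit [Fintype V] [DecidableEq V] [Fintype E] [DecidableEq E] in
/-- The head reaches `t` iff some arm and its leaf's route are open. -/
lemma lsmHead_head (hwt : w ≠ t) (hc : ∀ v ∈ A, arcs (c v) = {(w, v)})
    (honlyw : ∀ e, (∃ xy ∈ arcs e, xy.1 = w) → ∃ v ∈ A, e = c v) :
    bwdEvent arcs w {t} = ⋃ v ∈ A, (openEdge (c v) ∩ bwdEvent arcs v {t}) := by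
  ext ω
  simp only [Set.mem_iUnion, Set.mem_inter_iff, exists_prop]
  constructor
  · intro h
    simp only [bwdEvent, Set.mem_setOf_eq, Finset.mem_singleton, exists_eq_left] at h
    rcases Relation.ReflTransGen.cases_head h with heq | ⟨y, ⟨e, he, hxy⟩, hyt⟩
    · exact absurd heq hwt
    · obtain ⟨v, hv, rfl⟩ := honlyw e ⟨(w, y), hxy, rfl⟩
      rw [hc v hv, Finset.mem_singleton, Prod.mk.injEq] at hxy
      refine ⟨v, hv, he, ?_⟩
      simp only [bwdEvent, Set.mem_setOf_eq, Finset.mem_singleton, exists_eq_left]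
      exact hxy.2 ▸ hyt
  · rintro ⟨v, hv, hcv, hvt⟩
    simp only [bwdEvent, Set.mem_setOf_eq, Finset.mem_singleton, exists_eq_left] at hvt ⊢
    exact reach_trans
      (reach_of_openArc ⟨c v, hcv, by rw [hc v hv]; exact Finset.mem_singleton_self _⟩) hvt

omit [Fintype V] [DecidableEq V] [Fintype E] [DecidableEq E] in
/-- The arm coins are injective on the leaves. -/
lemma lsmHead_c_injOn (hc : ∀ v ∈ A, arcs (c v) = {(w, v)}) : Set.InjOn c A := by
  intro v hv v' hv' h
  have h1 := hc v hv
  have h2 := hc v' hv'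
  rw [h] at h1
  rw [h1, Finset.singleton_inj, Prod.mk.injEq] at h2
  exact h2.2

omit [Fintype V] [Fintype E] in
/-- The level of a trace `L ⊆ Vs` (`w ∉ K⁻`) is the sub-head level with every arm into `L`
closed. -/
lemma traceLevel_lsmHead_notMem (hwV : w ∉ Vs) (hwt : w ≠ t) (hAV : A ⊆ Vs)
    (hc : ∀ v ∈ A, arcs (c v) = {(w, v)})
    (honlyw : ∀ e, (∃ xy ∈ arcs e, xy.1 = w) → ∃ v ∈ A, e = c v) {L : Finset V} (hL : L ⊆ Vs) :
    traceLevel arcs {t} (insert w Vs) L =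
      traceLevel arcs {t} Vs L ∩ allClosed ((L ∩ A).image c) := by
  ext ω
  simp only [traceLevel, Set.mem_setOf_eq, Finset.forall_mem_insert, Set.mem_inter_iff,
    mem_allClosed, Finset.mem_image, forall_exists_index, and_imp]
  have hwL : w ∉ L := fun h => hwV (hL h)
  have hhead := lsmHead_head hwt hc honlyw
  constructor
  · rintro ⟨hw, hv⟩
    refine ⟨hv, fun e v hv' he => ?_⟩
    have hv'' := Finset.mem_inter.mp hv'
    have hwK : ω ∉ bwdEvent arcs w {t} := fun h => hwL (hw.mpr h)
    rw [hhead] at hwK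
    simp only [Set.mem_iUnion, Set.mem_inter_iff, not_exists, not_and] at hwK
    have hmem : ω (c v) = false := Bool.eq_false_iff.mpr fun h =>
      hwK v hv''.2 h ((hv v (hL hv''.1)).mp hv''.1)
    rw [he] at hmem; exact hmem
  · rintro ⟨hv, hcl⟩
    refine ⟨⟨fun h => absurd h hwL, fun hw => ?_⟩, hv⟩
    rw [hhead] at hw
    simp only [Set.mem_iUnion, Set.mem_inter_iff] at hw
    obtain ⟨v, hv', hcv, hvt⟩ := hw
    have hvL : v ∈ L := (hv v (hAV hv')).mpr hvt
    have := hcl (c v) v (Finset.mem_inter.mpr ⟨hvL, hv'⟩) rfl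
    exact absurd (this ▸ hcv) Bool.false_ne_true

omit [Fintype V] [Fintype E] in
/-- The level of the trace `L ∪ {w}` (`w ∈ K⁻`) is the sub-head level minus «every arm into `L`
closed». -/
lemma traceLevel_lsmHead_mem (hwV : w ∉ Vs) (hwt : w ≠ t) (hAV : A ⊆ Vs)
    (hc : ∀ v ∈ A, arcs (c v) = {(w, v)})
    (honlyw : ∀ e, (∃ xy ∈ arcs e, xy.1 = w) → ∃ v ∈ A, e = c v) {L : Finset V} (hL : L ⊆ Vs) :
    traceLevel arcs {t} (insert w Vs) (insert w L) =
      traceLevel arcs {t} Vs L \ allClosed ((L ∩ A).image c) := by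
  ext ω
  simp only [traceLevel, Set.mem_setOf_eq, Finset.forall_mem_insert, Set.mem_sdiff,
    mem_allClosed, Finset.mem_image, forall_exists_index, and_imp, Finset.mem_insert_self,
    true_iff]
  have hvins : ∀ v ∈ Vs, (v ∈ insert w L ↔ v ∈ L) := fun v hv =>
    ⟨fun h => (Finset.mem_insert.mp h).resolve_left fun h' => hwV (h' ▸ hv), fun h =>
      Finset.mem_insert_of_mem h⟩
  have hhead := lsmHead_head hwt hc honlyw
  constructor
  · rintro ⟨hw, hv⟩
    have hv' : ∀ v ∈ Vs, (v ∈ L ↔ ω ∈ bwdEvent arcs v {t}) := fun v hv'' => by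
      rw [← hvins v hv'']; exact hv v hv''
    refine ⟨hv', fun hall => ?_⟩
    rw [hhead] at hw
    simp only [Set.mem_iUnion, Set.mem_inter_iff] at hw
    obtain ⟨v, hv'', hcv, hvt⟩ := hw
    have := hall (c v) v (Finset.mem_inter.mpr ⟨(hv' v (hAV hv'')).mpr hvt, hv''⟩) rfl
    exact absurd (this ▸ hcv) Bool.false_ne_true
  · rintro ⟨hv, hnot⟩
    refine ⟨?_, fun v hv' => by rw [hvins v hv']; exact hv v hv'⟩
    rw [hhead]
    simp only [Set.mem_iUnion, Set.mem_inter_iff]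
    by_contra hcon
    simp only [not_exists, not_and] at hcon
    apply hnot
    intro e v hvL he
    have hvL' := Finset.mem_inter.mp hvL
    have hmem : ω (c v) = false := Bool.eq_false_iff.mpr fun h =>
      hcon v hvL'.2 h ((hv v (hL hvL'.1)).mp hvL'.1)
    rw [he] at hmem; exact hmem

omit [Fintype V] [DecidableEq V] [Fintype E] [DecidableEq E] [Field R] [LinearOrder R]
  [IsStrictOrderedRing R] in
/-- «All closed» depends on its coins only. -/
lemma dependsOn_allClosed' (F : Finset E) : DependsOn (· ∈ allClosed F) (↑F : Set E) := by
  intro ω ω' h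
  simp only [allClosed, Set.mem_setOf_eq]
  exact propext ⟨fun hω e he => by rw [← h e (Finset.mem_coe.2 he)]; exact hω e he,
    fun hω e he => by rw [h e (Finset.mem_coe.2 he)]; exact hω e he⟩

omit [Fintype V] [LinearOrder R] [IsStrictOrderedRing R] in
/-- **The trace law of the head at `L`** (`w ∉ K⁻`): `P(trace = L) = β L · ∏_{v ∈ L} (1 − p (c v))`
with `β L = P(K⁻ ∩ Vs = L)`. -/
theorem prob_traceLevel_lsmHead_notMem (p : E → R) (hwV : w ∉ Vs) (hwt : w ≠ t) (hAV : A ⊆ Vs)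
    (hclosed : ClosedOut arcs (insert w Vs) {t}) (hc : ∀ v ∈ A, arcs (c v) = {(w, v)})
    (honlyw : ∀ e, (∃ xy ∈ arcs e, xy.1 = w) → ∃ v ∈ A, e = c v)
    (hnoback : ∀ e, ∀ xy ∈ arcs e, xy.1 ∈ Vs → xy.2 ≠ w) {L : Finset V} (hL : L ⊆ Vs) :
    prob p (traceLevel arcs {t} (insert w Vs) L) =
      hA (fun L => prob p (traceLevel arcs {t} Vs L))
        (fun v => if v ∈ A then 1 - p (c v) else 1) L := by
  rw [traceLevel_lsmHead_notMem hwV hwt hAV hc honlyw hL]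
  have hdisj : Disjoint (tailCoins arcs Vs) (↑((L ∩ A).image c) : Set E) := by
    rw [Set.disjoint_right]
    intro e he
    obtain ⟨v, hv, rfl⟩ := Finset.mem_image.mp (Finset.mem_coe.mp he)
    exact lsmHead_arm_notMem_tailCoins hwV hc (Finset.mem_inter.mp hv).2
  rw [prob_inter_eq_mul_of_dependsOn p hdisj
    (dependsOn_traceLevel (lsmHead_closedOut_sub hclosed hnoback) L) (dependsOn_allClosed' _),
    prob_allClosed, Finset.prod_image (fun x hx y hy h =>
      lsmHead_c_injOn hc (Finset.mem_inter.mp hx).2 (Finset.mem_inter.mp hy).2 h)]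
  simp only [hA, armProd, Finset.prod_ite_mem]

omit [Fintype V] [LinearOrder R] [IsStrictOrderedRing R] in
/-- **The trace law of the head at `L ∪ {w}`** (`w ∈ K⁻`): `β L · (1 − ∏_{v ∈ L} (1 − p (c v)))`. -/
theorem prob_traceLevel_lsmHead_mem (p : E → R) (hwV : w ∉ Vs) (hwt : w ≠ t) (hAV : A ⊆ Vs)
    (hclosed : ClosedOut arcs (insert w Vs) {t}) (hc : ∀ v ∈ A, arcs (c v) = {(w, v)})
    (honlyw : ∀ e, (∃ xy ∈ arcs e, xy.1 = w) → ∃ v ∈ A, e = c v)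
    (hnoback : ∀ e, ∀ xy ∈ arcs e, xy.1 ∈ Vs → xy.2 ≠ w) {L : Finset V} (hL : L ⊆ Vs) :
    prob p (traceLevel arcs {t} (insert w Vs) (insert w L)) =
      hB (fun L => prob p (traceLevel arcs {t} Vs L))
        (fun v => if v ∈ A then 1 - p (c v) else 1) L := by
  have h1 := prob_traceLevel_lsmHead_notMem p hwV hwt hAV hclosed hc honlyw hnoback hL
  rw [traceLevel_lsmHead_notMem hwV hwt hAV hc honlyw hL] at h1
  rw [traceLevel_lsmHead_mem hwV hwt hAV hc honlyw hL]
  have h := prob_inter_add_prob_inter_compl p (traceLevel arcs {t} Vs L)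
    (allClosed ((L ∩ A).image c))
  rw [Set.sdiff_eq]
  simp only [hA] at h1
  simp only [hB]
  linear_combination h - h1

/-- **THEOREM (row 2′DARC at every head with a log-supermodular sub-head trace law, mixed coin
systems).** -/
theorem darc_of_lsmHead_mixed (p : E → R) (hp : IsProbVec p) {arcs : E → Finset (V × V)}
    (hS : SameEnds arcs) (s a b u w t : V) (Vs : Finset V) (hwV : w ∉ Vs) (hwt : w ≠ t)
    (hclosed : ClosedOut arcs (insert w Vs) {t}) (hT : TailCoinsIn arcs (insert w Vs) {t})
    (A : Finset V) (hAV : A ⊆ Vs) {c : V → E} (hc : ∀ v ∈ A, arcs (c v) = {(w, v)})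
    (honlyw : ∀ e, (∃ xy ∈ arcs e, xy.1 = w) → ∃ v ∈ A, e = c v)
    (hnoback : ∀ e, ∀ xy ∈ arcs e, xy.1 ∈ Vs → xy.2 ≠ w)
    (hβ : ∀ L L', L ⊆ Vs → L' ⊆ Vs →
      prob p (traceLevel arcs {t} Vs L) * prob p (traceLevel arcs {t} Vs L') ≤
        prob p (traceLevel arcs {t} Vs (L ∩ L')) * prob p (traceLevel arcs {t} Vs (L ∪ L')))
    (ha : a ∉ insert w Vs ∪ {t}) (hb : b ∉ insert w Vs ∪ {t}) (hu : u ∉ insert w Vs ∪ {t})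
    (hP : ∀ Z ∈ (insert w Vs).powerset,
      0 < prob p (avoidEvent (arcsOff arcs (insert w Vs ∪ {t})) s (Z ∪ {t})))
    (hQ : ∀ Z ∈ (insert w Vs).powerset,
      0 < prob p (avoidEvent (arcsOff arcs (insert w Vs ∪ {t})) s (gateTarget u w Z {t}))) :
    DARC p arcs s {t} a b u w := by
  have hwP : w ∈ insert w Vs := Finset.mem_insert_self w Vs
  have hS₀ : SameEnds (arcsOff arcs (insert w Vs ∪ {t})) := sameEnds_arcsOff hS _
  refine darc_of_trace_functional p hp hS hclosed hT s a b u w hwP ha hb hu hQ ?_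
  -- the avoidance function of the reduced system and the trace data
  set D₀ := arcsOff arcs (insert w Vs ∪ {t}) with hD₀
  set F : Finset V → R := fun S => prob p (avoidEvent D₀ s (S ∪ {t})) with hF
  set ℓ : Finset V → R := fun Z => prob p (traceLevel arcs {t} (insert w Vs) Z) with hℓ
  set Qz : Finset V → R := fun Z => prob p (avoidEvent D₀ s (gateTarget u w Z {t})) with hQz
  set Az : Finset V → R := fun Z =>
    massE p (marker (R := R) D₀ s a) (avoidEvent D₀ s (Z ∪ {t})) with hAz
  set Bz : Finset V → R := fun Z =>
    massE p (marker (R := R) D₀ s b) (avoidEvent D₀ s (Z ∪ {t})) with hBz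
  set Ahz : Finset V → R := fun Z =>
    massE p (marker (R := R) D₀ s a) (avoidEvent D₀ s (gateTarget u w Z {t})) with hAhz
  set Bhz : Finset V → R := fun Z =>
    massE p (marker (R := R) D₀ s b) (avoidEvent D₀ s (gateTarget u w Z {t})) with hBhz
  set β : Finset V → R := fun L => prob p (traceLevel arcs {t} Vs L) with hβdef
  set q : V → R := fun v => if v ∈ A then 1 - p (c v) else 1 with hq
  set Ga : Finset V → R := fun S => F (insert a S) with hGa
  set Gb : Finset V → R := fun S => F (insert b S) with hGb
  show 0 ≤ ∑ Z ∈ (insert w Vs).powerset, ℓ Z * Qz Z *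
      (Ahz Z / Qz Z * (∑ Z' ∈ (insert w Vs).powerset, ℓ Z' * F Z') -
        ∑ Z' ∈ (insert w Vs).powerset, ℓ Z' * Az Z') *
      (Bhz Z / Qz Z * (∑ Z' ∈ (insert w Vs).powerset, ℓ Z' * F Z') -
        ∑ Z' ∈ (insert w Vs).powerset, ℓ Z' * Bz Z')
  -- membership facts
  have huV : u ∉ Vs := fun h => hu (Finset.mem_union_left _ (Finset.mem_insert_of_mem h))
  have hwu : w ≠ u := fun h => hu (Finset.mem_union_left _ (h ▸ hwP))
  have hwnotin : ∀ L ⊆ Vs, w ∉ L := fun L hL h => hwV (hL h)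
  have hLP : ∀ L ⊆ Vs, L ∈ (insert w Vs).powerset := fun L hL =>
    Finset.mem_powerset.mpr (hL.trans (Finset.subset_insert w Vs))
  have hwLP : ∀ L ⊆ Vs, insert w L ∈ (insert w Vs).powerset := fun L hL =>
    Finset.mem_powerset.mpr (Finset.insert_subset_insert w hL)
  -- the hypotheses of the abstract lemma
  have hF0 : ∀ S, 0 ≤ F S := fun S => prob_nonneg hp _
  have hFdec : ∀ S S', S ⊆ S' → F S' ≤ F S := fun S S' h =>
    prob_mono hp (avoidEvent_anti _ _ (Finset.union_subset_union_left h))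
  have hFlsm : ∀ S S', F S * F S' ≤ F (S ∩ S') * F (S ∪ S') := fun S S' => by
    have h := prob_avoid_lsm p hp hS₀ s (S ∪ {t}) (S' ∪ {t})
    rwa [union_singleton_inter, union_singleton_union] at h
  have hFpos : ∀ L ⊆ Vs, 0 < F L := fun L hL => hP L (hLP L hL)
  have hgate_w : ∀ L : Finset V, gateTarget u w (insert w L) {t} = insert u (insert w L) ∪ {t} := by
    intro L
    rw [gateTarget_of_mem (Finset.mem_insert_self w L)]
    simp only [Finset.insert_union]
  have hFposwu : ∀ L ⊆ Vs, 0 < F (insert u (insert w L)) := fun L hL => by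
    have h := hQ (insert w L) (hwLP L hL)
    rwa [hgate_w L] at h
  have hβ0 : ∀ L ⊆ Vs, 0 ≤ β L := fun L _ => prob_nonneg hp _
  have hq0 : ∀ i ∈ Vs, 0 ≤ q i := fun i _ => by
    show 0 ≤ (if i ∈ A then 1 - p (c i) else 1)
    split_ifs
    · linarith [hp.le_one (c i)]
    · exact zero_le_one
  have hq1 : ∀ i ∈ Vs, q i ≤ 1 := fun i _ => by
    show (if i ∈ A then 1 - p (c i) else 1) ≤ 1
    split_ifs
    · linarith [hp.nonneg (c i)]
    · exact le_rfl
  have hGa0 : ∀ S, 0 ≤ Ga S := fun S => hF0 _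
  have hGb0 : ∀ S, 0 ≤ Gb S := fun S => hF0 _
  have hGam : ∀ S S', S ⊆ S' → Ga S * F S' ≤ Ga S' * F S := fun S S' h =>
    insert_ratio_cleared hF0 hFdec hFlsm a h
  have hGbm : ∀ S S', S ⊆ S' → Gb S * F S' ≤ Gb S' * F S := fun S S' h =>
    insert_ratio_cleared hF0 hFdec hFlsm b h
  -- the trace data in terms of `F`, `kA`, `kB`
  have hℓL : ∀ L ⊆ Vs, ℓ L = hA β q L := fun L hL =>
    prob_traceLevel_lsmHead_notMem p hwV hwt hAV hclosed hc honlyw hnoback hL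
  have hℓw : ∀ L ⊆ Vs, ℓ (insert w L) = hB β q L := fun L hL =>
    prob_traceLevel_lsmHead_mem p hwV hwt hAV hclosed hc honlyw hnoback hL
  have hQL : ∀ L ⊆ Vs, Qz L = F L := fun L hL => by
    show prob p (avoidEvent D₀ s (gateTarget u w L {t})) = prob p (avoidEvent D₀ s (L ∪ {t}))
    rw [gateTarget_of_notMem (hwnotin L hL)]
  have hQw : ∀ L : Finset V, Qz (insert w L) = F (insert u (insert w L)) := fun L => by
    show prob p (avoidEvent D₀ s (gateTarget u w (insert w L) {t})) = _
    rw [hgate_w L]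
  have hAzF : ∀ Z, Az Z = F Z - Ga Z := fun Z => by
    show massE p (marker (R := R) D₀ s a) (avoidEvent D₀ s (Z ∪ {t})) =
      prob p (avoidEvent D₀ s (Z ∪ {t})) - prob p (avoidEvent D₀ s (insert a Z ∪ {t}))
    rw [massE_marker_avoid, Finset.insert_union]
  have hBzF : ∀ Z, Bz Z = F Z - Gb Z := fun Z => by
    show massE p (marker (R := R) D₀ s b) (avoidEvent D₀ s (Z ∪ {t})) =
      prob p (avoidEvent D₀ s (Z ∪ {t})) - prob p (avoidEvent D₀ s (insert b Z ∪ {t}))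
    rw [massE_marker_avoid, Finset.insert_union]
  have hAhzL : ∀ L ⊆ Vs, Ahz L = F L - Ga L := fun L hL => by
    show massE p (marker (R := R) D₀ s a) (avoidEvent D₀ s (gateTarget u w L {t})) =
      prob p (avoidEvent D₀ s (L ∪ {t})) - prob p (avoidEvent D₀ s (insert a L ∪ {t}))
    rw [gateTarget_of_notMem (hwnotin L hL), massE_marker_avoid, Finset.insert_union]
  have hBhzL : ∀ L ⊆ Vs, Bhz L = F L - Gb L := fun L hL => by
    show massE p (marker (R := R) D₀ s b) (avoidEvent D₀ s (gateTarget u w L {t})) =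
      prob p (avoidEvent D₀ s (L ∪ {t})) - prob p (avoidEvent D₀ s (insert b L ∪ {t}))
    rw [gateTarget_of_notMem (hwnotin L hL), massE_marker_avoid, Finset.insert_union]
  have hAhzw : ∀ L : Finset V,
      Ahz (insert w L) = F (insert u (insert w L)) - Ga (insert u (insert w L)) :=
    fun L => by
      show massE p (marker (R := R) D₀ s a) (avoidEvent D₀ s (gateTarget u w (insert w L) {t})) =
        prob p (avoidEvent D₀ s (insert u (insert w L) ∪ {t})) -
          prob p (avoidEvent D₀ s (insert a (insert u (insert w L)) ∪ {t}))
      rw [hgate_w L, massE_marker_avoid]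
      simp only [Finset.insert_union]
  have hBhzw : ∀ L : Finset V,
      Bhz (insert w L) = F (insert u (insert w L)) - Gb (insert u (insert w L)) :=
    fun L => by
      show massE p (marker (R := R) D₀ s b) (avoidEvent D₀ s (gateTarget u w (insert w L) {t})) =
        prob p (avoidEvent D₀ s (insert u (insert w L) ∪ {t})) -
          prob p (avoidEvent D₀ s (insert b (insert u (insert w L)) ∪ {t}))
      rw [hgate_w L, massE_marker_avoid]
      simp only [Finset.insert_union]
  -- splitting the powerset of `insert w Vs`
  have hsplit : ∀ g : Finset V → R, ∑ Z ∈ (insert w Vs).powerset, g Z =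
      ∑ L ∈ Vs.powerset, g L + ∑ L ∈ Vs.powerset, g (insert w L) := fun g => by
    have h := sum_powerset_split (Vs := insert w Vs) (i := w) hwP g
    rwa [Finset.erase_insert hwV] at h
  -- the total mass and the marker masses
  have eΛ : ∑ Z' ∈ (insert w Vs).powerset, ℓ Z' * F Z' = hLam Vs β q w F := by
    rw [hsplit, hLam, ← Finset.sum_add_distrib]
    refine Finset.sum_congr rfl fun L hL => ?_
    rw [hℓL L (Finset.mem_powerset.mp hL), hℓw L (Finset.mem_powerset.mp hL)]
  have eMX : ∑ Z' ∈ (insert w Vs).powerset, ℓ Z' * Az Z' = hLam Vs β q w F - hMass Vs β q w Ga := by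
    rw [← eΛ, hsplit, hsplit, hMass, ← Finset.sum_add_distrib, ← Finset.sum_add_distrib,
      ← Finset.sum_sub_distrib]
    refine Finset.sum_congr rfl fun L hL => ?_
    rw [hAzF, hAzF, hℓL L (Finset.mem_powerset.mp hL), hℓw L (Finset.mem_powerset.mp hL)]
    ring
  have eMY : ∑ Z' ∈ (insert w Vs).powerset, ℓ Z' * Bz Z' = hLam Vs β q w F - hMass Vs β q w Gb := by
    rw [← eΛ, hsplit, hsplit, hMass, ← Finset.sum_add_distrib, ← Finset.sum_add_distrib,
      ← Finset.sum_sub_distrib]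
    refine Finset.sum_congr rfl fun L hL => ?_
    rw [hBzF, hBzF, hℓL L (Finset.mem_powerset.mp hL), hℓw L (Finset.mem_powerset.mp hL)]
    ring
  rw [eΛ, eMX, eMY, hsplit]
  -- the two kinds of traces
  have e₁ : ∑ L ∈ Vs.powerset, ℓ L * Qz L *
      (Ahz L / Qz L * hLam Vs β q w F - (hLam Vs β q w F - hMass Vs β q w Ga)) *
      (Bhz L / Qz L * hLam Vs β q w F - (hLam Vs β q w F - hMass Vs β q w Gb)) =
      ∑ L ∈ Vs.powerset, hA β q L * F L *
        (Ga L / F L * hLam Vs β q w F - hMass Vs β q w Ga) *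
        (Gb L / F L * hLam Vs β q w F - hMass Vs β q w Gb) := by
    refine Finset.sum_congr rfl fun L hL => ?_
    have hL := Finset.mem_powerset.mp hL
    have hne := (hFpos L hL).ne'
    rw [hℓL L hL, hQL L hL, hAhzL L hL, hBhzL L hL, sub_div, div_self hne, sub_div, div_self hne]
    ring
  have e₂ : ∑ L ∈ Vs.powerset, ℓ (insert w L) * Qz (insert w L) *
      (Ahz (insert w L) / Qz (insert w L) * hLam Vs β q w F -
        (hLam Vs β q w F - hMass Vs β q w Ga)) *
      (Bhz (insert w L) / Qz (insert w L) * hLam Vs β q w F -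
        (hLam Vs β q w F - hMass Vs β q w Gb)) =
      ∑ L ∈ Vs.powerset, hB β q L * F (insert u (insert w L)) *
        (Ga (insert u (insert w L)) / F (insert u (insert w L)) * hLam Vs β q w F -
          hMass Vs β q w Ga) *
        (Gb (insert u (insert w L)) / F (insert u (insert w L)) * hLam Vs β q w F -
          hMass Vs β q w Gb) := by
    refine Finset.sum_congr rfl fun L hL => ?_
    have hL := Finset.mem_powerset.mp hL
    have hne := (hFposwu L hL).ne'
    rw [hℓw L hL, hQw L, hAhzw L, hBhzw L, sub_div, div_self hne, sub_div, div_self hne]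
    ring
  rw [e₁, e₂]
  exact lsmHead_functional_nonneg Vs w u hwV huV hwu F Ga Gb hF0 hFdec hFlsm hFpos hFposwu hGa0
    hGb0 hGam hGbm β hβ0 hβ q hq0 hq1

end LsmHead

end Summit.Ventures.PercRepro2.Coin
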